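import Mathlib
import HarnessLib
import Literature.MathematicalPhysics.QuantumLattice.KohnLuttinger
import Summits.HubbardSuperconductivity.HubbardSuperconductivity.Theorems.WeakCouplingBCSWcbcsKohnLuttingerB1gReduction

/-!
# `stub_klD4Invariant`: the point group `D₄` preserves the Fermi-curve measure

For the nearest-neighbour band `ε₀ = squareDispersion 1 0` and `μ ∈ (-4, 0)` every `γ ∈ D₄`
(acting on momenta by `d4Momentum`) is measure preserving for the density-of-states measure
`σ = fermiCurveMeasure ε₀ μ = ‖∇ε₀‖⁻¹ · μH[1]⌊F`, `F = fermiCurve ε₀ μ`.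

* `kl_d4_measurePreserving_withDensity`: a measure-preserving self-map leaving a measurable
  density invariant preserves the weighted measure (change of variables in the Lebesgue integral);
* `kl_d4_measurePreserving_of_isometry`: a surjective isometry `T` of momentum space with
  `T ⁻¹' F = F` and `‖∇ε (T k)‖ = ‖∇ε k‖` preserves `fermiCurveMeasure ε μ` (isometries preserve
  `μH[1]`; the density `‖∇ε‖⁻¹` is measurable for every `ε` by measurability of `fderiv`);
* the generators `rotMomentum`, `reflMomentum` of `D₄` are surjective isometries leaving `ε₀`
  invariant; for `μ < 0` the Fermi curve avoids the zone boundary (`F ⊂ (-π, π)²`), so it is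
  invariant too; granted `∇ε₀ = (2 sin k₀, 2 sin k₁)` so is the Fermi speed;
* `d4Momentum (r i) = rotⁱ`, `d4Momentum (sr i) = refl ∘ rotⁱ`: iterate and compose.
-/

noncomputable section

set_option linter.dupNamespace false

namespace Summit.HubbardSuperconductivity.HubbardSuperconductivity.Theorems

open MeasureTheory Literature.MathematicalPhysics.QuantumLattice
open scoped ENNReal

/-! ### Abstract part: invariant densities, isometries and the Fermi-curve measure -/

/-- A measure-preserving self-map leaving a measurable density invariant preserves the weighted
measure. [folklore] -/
theorem kl_d4_measurePreserving_withDensity {α : Type*} [MeasurableSpace α] {ν : Measure α}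
    {T : α → α} (hT : MeasurePreserving T ν ν) {g : α → ℝ≥0∞} (hg : Measurable g)
    (hinv : ∀ x, g (T x) = g x) :
    MeasurePreserving T (ν.withDensity g) (ν.withDensity g) := by
  refine ⟨hT.measurable, Measure.ext fun s hs => ?_⟩
  rw [Measure.map_apply hT.measurable hs, withDensity_apply _ (hT.measurable hs),
    withDensity_apply _ hs, ← hT.setLIntegral_comp_preimage hs hg]
  simp_rw [hinv]

/-- The inverse Fermi speed `‖∇ε‖⁻¹` (as an `ℝ≥0∞`-valued density) is measurable for every band
`ε` (measurability of `fderiv`, continuity of the Riesz isomorphism). [folklore] -/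
theorem kl_d4_measurable_density (ε : Momentum → ℝ) :
    Measurable fun k => ENNReal.ofReal (‖gradient ε k‖⁻¹) := by
  have h : Measurable (gradient ε) :=
    (InnerProductSpace.toDual ℝ Momentum).symm.continuous.measurable.comp (measurable_fderiv ℝ ε)
  exact h.norm.inv.ennreal_ofReal

/-- Surjective isometries of momentum space preserve arc length `μH[1]`. [folklore] -/
theorem kl_d4_measurePreserving_hausdorff {T : Momentum → Momentum} (hT : Isometry T)
    (hsurj : Function.Surjective T) :
    MeasurePreserving T (μH[1] : Measure Momentum) (μH[1] : Measure Momentum) :=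
  ⟨hT.continuous.measurable, by
    rw [hT.map_hausdorffMeasure (Or.inr hsurj), hsurj.range_eq, Measure.restrict_univ]⟩

/-- A surjective isometry of momentum space leaving the Fermi curve and the Fermi speed invariant
preserves the Fermi-curve measure. [folklore] -/
theorem kl_d4_measurePreserving_of_isometry {ε : Momentum → ℝ} (hε : Measurable ε) (μ : ℝ)
    {T : Momentum → Momentum} (hT : Isometry T) (hsurj : Function.Surjective T)
    (hF : T ⁻¹' fermiCurve ε μ = fermiCurve ε μ)
    (hspeed : ∀ k, ‖gradient ε (T k)‖ = ‖gradient ε k‖) :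
    MeasurePreserving T (fermiCurveMeasure ε μ) (fermiCurveMeasure ε μ) := by
  have h1 := (kl_d4_measurePreserving_hausdorff hT hsurj).restrict_preimage
    (measurableSet_fermiCurve hε μ)
  rw [hF] at h1
  unfold fermiCurveMeasure
  exact kl_d4_measurePreserving_withDensity h1 (kl_d4_measurable_density ε)
    (fun k => by rw [hspeed])

/-! ### The generators `rot`, `refl` of `D₄` -/

/-- First coordinate of the rotated momentum. [folklore] -/
@[simp] theorem kl_d4_rot_apply_zero (k : Momentum) : rotMomentum k 0 = -k 1 := by
  simp [rotMomentum]

/-- Second coordinate of the rotated momentum. [folklore] -/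
@[simp] theorem kl_d4_rot_apply_one (k : Momentum) : rotMomentum k 1 = k 0 := by
  simp [rotMomentum]

/-- First coordinate of the reflected momentum. [folklore] -/
@[simp] theorem kl_d4_refl_apply_zero (k : Momentum) : reflMomentum k 0 = k 0 := by
  simp [reflMomentum]

/-- Second coordinate of the reflected momentum. [folklore] -/
@[simp] theorem kl_d4_refl_apply_one (k : Momentum) : reflMomentum k 1 = -k 1 := by
  simp [reflMomentum]

/-- `rot⁴ = id`. [folklore] -/
theorem kl_d4_rot_rot_rot_rot (k : Momentum) :
    rotMomentum (rotMomentum (rotMomentum (rotMomentum k))) = k := by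
  ext i; fin_cases i <;> simp

/-- `refl² = id`. [folklore] -/
theorem kl_d4_refl_refl (k : Momentum) : reflMomentum (reflMomentum k) = k := by
  ext i; fin_cases i <;> simp

/-- `rot` is an isometry of momentum space. [folklore] -/
theorem kl_d4_rot_isometry : Isometry rotMomentum := by
  refine Isometry.of_dist_eq fun x y => ?_
  rw [EuclideanSpace.dist_eq, EuclideanSpace.dist_eq, Fin.sum_univ_two, Fin.sum_univ_two,
    kl_d4_rot_apply_zero, kl_d4_rot_apply_zero, kl_d4_rot_apply_one, kl_d4_rot_apply_one,
    dist_neg_neg, add_comm]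

/-- `rot` is surjective (`rot⁴ = id`). [folklore] -/
theorem kl_d4_rot_surjective : Function.Surjective rotMomentum :=
  fun k => ⟨rotMomentum (rotMomentum (rotMomentum k)), kl_d4_rot_rot_rot_rot k⟩

/-- `refl` is an isometry of momentum space. [folklore] -/
theorem kl_d4_refl_isometry : Isometry reflMomentum := by
  refine Isometry.of_dist_eq fun x y => ?_
  rw [EuclideanSpace.dist_eq, EuclideanSpace.dist_eq, Fin.sum_univ_two, Fin.sum_univ_two,
    kl_d4_refl_apply_zero, kl_d4_refl_apply_zero, kl_d4_refl_apply_one, kl_d4_refl_apply_one,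
    dist_neg_neg]

/-- `refl` is surjective (`refl² = id`). [folklore] -/
theorem kl_d4_refl_surjective : Function.Surjective reflMomentum :=
  fun k => ⟨reflMomentum k, kl_d4_refl_refl k⟩

/-! ### Invariance of `ε₀`, of the Fermi curve and of the Fermi speed -/

/-- `ε₀ k = -2 (cos k₀ + cos k₁)`. [folklore] -/
theorem kl_d4_eps_apply (k : Momentum) :
    squareDispersion 1 0 k = -2 * (Real.cos (k 0) + Real.cos (k 1)) := by
  simp only [squareDispersion]
  ring

/-- `ε₀ ∘ rot = ε₀`. [folklore] -/
theorem kl_d4_eps_rot (k : Momentum) :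
    squareDispersion 1 0 (rotMomentum k) = squareDispersion 1 0 k := by
  rw [kl_d4_eps_apply, kl_d4_eps_apply, kl_d4_rot_apply_zero, kl_d4_rot_apply_one, Real.cos_neg]
  ring

/-- `ε₀ ∘ refl = ε₀`. [folklore] -/
theorem kl_d4_eps_refl (k : Momentum) :
    squareDispersion 1 0 (reflMomentum k) = squareDispersion 1 0 k := by
  rw [kl_d4_eps_apply, kl_d4_eps_apply, kl_d4_refl_apply_zero, kl_d4_refl_apply_one, Real.cos_neg]

/-- Below half filling (`μ < 0`) the Fermi curve of `ε₀` avoids the zone boundary `kᵢ = -π`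
(there `ε₀ = 2 - 2 cos k_j ≥ 0`), so membership is symmetric in the signs of the coordinates:
`k ∈ F ↔ (|k₀| < π ∧ |k₁| < π) ∧ ε₀ k = μ`. [folklore] -/
theorem kl_d4_mem_fermiCurve_iff {μ : ℝ} (hμ : μ < 0) (k : Momentum) :
    k ∈ fermiCurve (squareDispersion 1 0) μ ↔
      (|k 0| < Real.pi ∧ |k 1| < Real.pi) ∧ squareDispersion 1 0 k = μ := by
  rw [mem_fermiCurve_iff]
  simp only [brillouinZone, Set.mem_setOf_eq, Fin.forall_fin_two, Set.mem_Ico, abs_lt]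
  constructor
  · rintro ⟨⟨⟨h0, h0'⟩, h1, h1'⟩, hε⟩
    refine ⟨⟨⟨lt_of_le_of_ne h0 ?_, h0'⟩, lt_of_le_of_ne h1 ?_, h1'⟩, hε⟩
    · intro h
      rw [kl_d4_eps_apply, ← h, Real.cos_neg, Real.cos_pi] at hε
      have := Real.cos_le_one (k 1)
      linarith
    · intro h
      rw [kl_d4_eps_apply, ← h, Real.cos_neg, Real.cos_pi] at hε
      have := Real.cos_le_one (k 0)
      linarith
  · rintro ⟨⟨⟨h0, h0'⟩, h1, h1'⟩, hε⟩
    exact ⟨⟨⟨h0.le, h0'⟩, h1.le, h1'⟩, hε⟩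

/-- For `μ < 0` the Fermi curve of `ε₀` is `rot`-invariant. [folklore] -/
theorem kl_d4_rot_preimage {μ : ℝ} (hμ : μ < 0) :
    rotMomentum ⁻¹' fermiCurve (squareDispersion 1 0) μ = fermiCurve (squareDispersion 1 0) μ := by
  ext k
  rw [Set.mem_preimage, kl_d4_mem_fermiCurve_iff hμ, kl_d4_mem_fermiCurve_iff hμ, kl_d4_eps_rot,
    kl_d4_rot_apply_zero, kl_d4_rot_apply_one, abs_neg]
  tauto

/-- For `μ < 0` the Fermi curve of `ε₀` is `refl`-invariant. [folklore] -/
theorem kl_d4_refl_preimage {μ : ℝ} (hμ : μ < 0) :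
    reflMomentum ⁻¹' fermiCurve (squareDispersion 1 0) μ = fermiCurve (squareDispersion 1 0) μ := by
  ext k
  rw [Set.mem_preimage, kl_d4_mem_fermiCurve_iff hμ, kl_d4_mem_fermiCurve_iff hμ, kl_d4_eps_refl,
    kl_d4_refl_apply_zero, kl_d4_refl_apply_one, abs_neg]

/-- `‖(a, b)‖ = √(a² + b²)` in `ℝ²`. [folklore] -/
theorem kl_d4_norm_mk (a b : ℝ) : ‖(WithLp.toLp 2 ![a, b] : Momentum)‖ = √(a ^ 2 + b ^ 2) := by
  rw [EuclideanSpace.norm_eq, Fin.sum_univ_two]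
  simp

/-- Granted `∇ε₀ = (2 sin k₀, 2 sin k₁)`, the Fermi speed is `rot`-invariant. [folklore] -/
theorem kl_d4_speed_rot
    (hgrad : ∀ k : Momentum, gradient (squareDispersion 1 0) k =
      WithLp.toLp 2 ![2 * Real.sin (k 0), 2 * Real.sin (k 1)]) (k : Momentum) :
    ‖gradient (squareDispersion 1 0) (rotMomentum k)‖ = ‖gradient (squareDispersion 1 0) k‖ := by
  rw [hgrad, hgrad, kl_d4_norm_mk, kl_d4_norm_mk, kl_d4_rot_apply_zero, kl_d4_rot_apply_one,
    Real.sin_neg, mul_neg, neg_sq, add_comm]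

/-- Granted `∇ε₀ = (2 sin k₀, 2 sin k₁)`, the Fermi speed is `refl`-invariant. [folklore] -/
theorem kl_d4_speed_refl
    (hgrad : ∀ k : Momentum, gradient (squareDispersion 1 0) k =
      WithLp.toLp 2 ![2 * Real.sin (k 0), 2 * Real.sin (k 1)]) (k : Momentum) :
    ‖gradient (squareDispersion 1 0) (reflMomentum k)‖ = ‖gradient (squareDispersion 1 0) k‖ := by
  rw [hgrad, hgrad, kl_d4_norm_mk, kl_d4_norm_mk, kl_d4_refl_apply_zero, kl_d4_refl_apply_one,
    Real.sin_neg, mul_neg, neg_sq]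

/-- Granted the gradient formula, `rot` preserves the Fermi-curve measure of `ε₀` for `μ < 0`.
[folklore] -/
theorem kl_d4_rot_measurePreserving
    (hgrad : ∀ k : Momentum, gradient (squareDispersion 1 0) k =
      WithLp.toLp 2 ![2 * Real.sin (k 0), 2 * Real.sin (k 1)]) {μ : ℝ} (hμ : μ < 0) :
    MeasurePreserving rotMomentum (fermiCurveMeasure (squareDispersion 1 0) μ)
      (fermiCurveMeasure (squareDispersion 1 0) μ) :=
  kl_d4_measurePreserving_of_isometry (measurable_squareDispersion 1 0) μ kl_d4_rot_isometry
    kl_d4_rot_surjective (kl_d4_rot_preimage hμ) (kl_d4_speed_rot hgrad)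

/-- Granted the gradient formula, `refl` preserves the Fermi-curve measure of `ε₀` for `μ < 0`.
[folklore] -/
theorem kl_d4_refl_measurePreserving
    (hgrad : ∀ k : Momentum, gradient (squareDispersion 1 0) k =
      WithLp.toLp 2 ![2 * Real.sin (k 0), 2 * Real.sin (k 1)]) {μ : ℝ} (hμ : μ < 0) :
    MeasurePreserving reflMomentum (fermiCurveMeasure (squareDispersion 1 0) μ)
      (fermiCurveMeasure (squareDispersion 1 0) μ) :=
  kl_d4_measurePreserving_of_isometry (measurable_squareDispersion 1 0) μ kl_d4_refl_isometry
    kl_d4_refl_surjective (kl_d4_refl_preimage hμ) (kl_d4_speed_refl hgrad)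

/-! ### The stub -/

/-- **Stub `stub_klD4Invariant`**: granted the gradient formula, every element of the point group
`D₄` (acting by `d4Momentum`: linear isometries of momentum space) preserves the Fermi-curve measure of
the `D₄`-symmetric band `ε₀` for `μ ∈ (-4, 0)` (there `F ⊂ (-π,π)²`, so `F`, `μH[1]` and `‖∇ε₀‖` are
all invariant). [folklore] -/
theorem stub_klD4Invariant :
    (∀ k : Momentum, gradient (squareDispersion 1 0) k = WithLp.toLp 2 ![2 * Real.sin (k 0), 2 * Real.sin (k 1)]) →
    ∀ μ ∈ Set.Ioo (-4 : ℝ) 0, ∀ γ : DihedralGroup 4,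
      MeasurePreserving (d4Momentum γ) (fermiCurveMeasure (squareDispersion 1 0) μ) (fermiCurveMeasure (squareDispersion 1 0) μ) := by
  intro hgrad μ hμ γ
  have hrot := kl_d4_rot_measurePreserving hgrad hμ.2
  have hrefl := kl_d4_refl_measurePreserving hgrad hμ.2
  cases γ with
  | r i =>
    have h : d4Momentum (DihedralGroup.r i) = rotMomentum^[i.val] := funext fun _ => rfl
    rw [h]
    exact hrot.iterate _
  | sr i =>
    have h : d4Momentum (DihedralGroup.sr i) = reflMomentum ∘ rotMomentum^[i.val] :=
      funext fun _ => rfl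
    rw [h]
    exact hrefl.comp (hrot.iterate _)

end Summit.HubbardSuperconductivity.HubbardSuperconductivity.Theorems

end
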